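import Mathlib
import HarnessLib
import Summits.HubbardSuperconductivity.HubbardSuperconductivity.Theorems.KLProgrammeKLRegimeTwoVolumeSubstitutionGluingBound

/-!
# Route `KLProgramme` — crux K3, the nested two-volume pass: a linear substitution pushes a DEEP-SMALL element to a deep-small element
# (companion of the substitution–gluing bracket; cell gate-hubbard-kl, seat hubbard-kl-k3c4-p1 g8; `--supports` stmt-…-20440)

In the inductive two-volume comparison the scale-`j` defect `D_j = 𝒲′_j − Glue 𝒲_j` (small at deep pins, bounded everywhere) is carried to the next scale's
representation by a linear substitution `map (toLin' T′)` (re-sectorisation / read-out).  The carried defect splits as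
`map T′ (𝒲′ − Glue 𝒲) + [map T′ (Glue 𝒲) − Glue (map T 𝒲)]`; the second bracket is `…TwoVolumeSubstitutionGluingDeepPin`, the first is this file:

* **`sum_pinned_norm_kernel_map_le_of_near`** — for a substitution with column sums `≤ a`, pin row `≤ a` and pin-row tail `≤ τ` beyond a near region, and an
  element `D` with pinned profile `≤ E` at near in-labels and `≤ ND` everywhere (degree `n+1`, leg `p`):
  `Σ_{X′ : X′_p = w′} ‖kernel (map T′ D) (n+1) X′‖ ≤ aⁿ·(a·E + τ·ND)`;
* `sum_pinned_norm_kernel_map_le` — the plain version `≤ aⁿ·a·ND` (no near region).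

Generic (any label types); everything is proved; no definition.  Ingredients: `GrassmannLinearSubstitution.kernel_map`, `…SubstitutionGluing.sum_pinned_prod_eq`,
`…SubstitutionGluingBound.sum_mul_apply_leg_le / prod_le_pow_card_of_le / card_univ_erase_fin`.
-/

noncomputable section

namespace Summit.HubbardSuperconductivity.HubbardSuperconductivity.Theorems.TwoVolumeDefect

set_option linter.dupNamespace false -- summit = problem name (single-conjunct summit), D-0017

open Finset Literature.MathematicalPhysics.QuantumLattice GrassmannAlgebra

variable {𝕜 : Type*} [RCLike 𝕜] {Γ₁' Γ₂' : Type*} [Fintype Γ₁'] [DecidableEq Γ₁'] [Fintype Γ₂'] [DecidableEq Γ₂']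

/-- **A substitution pushes a deep-small element to a deep-small element.**  With column sums `Σ_{x′} ‖T′ x′ y′‖ ≤ a`, the pin's row split into a near part
(total `≤ a`) and a far tail `Σ_{¬Near y′} ‖T′ w′ y′‖ ≤ τ`, and `D` with pinned profile `≤ E` at near in-labels and `≤ ND` at all in-labels:
`Σ_{X′ : X′_p = w′} ‖kernel (map T′ D) (n+1) X′‖ ≤ aⁿ·(a·E + τ·ND)`. [folklore] -/
theorem sum_pinned_norm_kernel_map_le_of_near (T' : Matrix Γ₂' Γ₁' 𝕜) (D : GrassmannAlgebra 𝕜 Γ₁') {n : ℕ} (p : Fin (n + 1)) (w' : Γ₂')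
    (Near : Γ₁' → Prop) [DecidablePred Near] {a τ E ND : ℝ} (ha : 0 ≤ a) (hE0 : 0 ≤ E) (hND0 : 0 ≤ ND)
    (hcol : ∀ y', ∑ x', ‖T' x' y'‖ ≤ a) (hrow : ∑ y' ∈ univ.filter (fun y' : Γ₁' => Near y'), ‖T' w' y'‖ ≤ a)
    (hτ : ∑ y' ∈ univ.filter (fun y' : Γ₁' => ¬ Near y'), ‖T' w' y'‖ ≤ τ)
    (hE : ∀ y', Near y' → ∑ Y' ∈ univ.filter (fun Y' : Fin (n + 1) → Γ₁' => Y' p = y'), ‖kernel 𝕜 D (n + 1) Y'‖ ≤ E)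
    (hND : ∀ y', ∑ Y' ∈ univ.filter (fun Y' : Fin (n + 1) → Γ₁' => Y' p = y'), ‖kernel 𝕜 D (n + 1) Y'‖ ≤ ND) :
    ∑ X' ∈ univ.filter (fun X' : Fin (n + 1) → Γ₂' => X' p = w'), ‖kernel 𝕜 (ExteriorAlgebra.map (Matrix.toLin' T') D) (n + 1) X'‖ ≤
      a ^ n * (a * E + τ * ND) := by
  classical
  set Xp := univ.filter (fun X' : Fin (n + 1) → Γ₂' => X' p = w') with hXp
  -- pointwise: `‖kernel (map T′ D) X′‖ ≤ Σ_{Y′} (∏ ‖T′‖) ‖D Y′‖`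
  have hpt : ∀ X' : Fin (n + 1) → Γ₂', ‖kernel 𝕜 (ExteriorAlgebra.map (Matrix.toLin' T') D) (n + 1) X'‖ ≤
      ∑ Y' : Fin (n + 1) → Γ₁', ‖kernel 𝕜 D (n + 1) Y'‖ * ∏ i, ‖T' (X' i) (Y' i)‖ := by
    intro X'
    rw [kernel_map]
    simp only [LinearMap.toMatrix'_toLin']
    refine (norm_sum_le _ _).trans (sum_le_sum fun Y' _ => ?_)
    rw [norm_mul, norm_prod, mul_comm]
  -- the pinned out-sum factorises
  have hX : ∀ Y' : Fin (n + 1) → Γ₁', ∑ X' ∈ Xp, ∏ i, ‖T' (X' i) (Y' i)‖ ≤ ‖T' w' (Y' p)‖ * a ^ n := by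
    intro Y'
    rw [hXp, sum_pinned_prod_eq (fun i x => ‖T' x (Y' i)‖) p w']
    refine mul_le_mul_of_nonneg_left ?_ (norm_nonneg _)
    calc ∏ i ∈ univ.erase p, ∑ x, ‖T' x (Y' i)‖ ≤ a ^ (univ.erase p).card :=
          prod_le_pow_card_of_le _ _ (fun i _ => sum_nonneg fun x _ => norm_nonneg _) fun i _ => hcol (Y' i)
      _ = a ^ n := by rw [card_univ_erase_fin]
  -- the pin row against the two profiles
  have hpin : ∑ Y' : Fin (n + 1) → Γ₁', ‖kernel 𝕜 D (n + 1) Y'‖ * ‖T' w' (Y' p)‖ ≤ a * E + τ * ND := by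
    rw [sum_mul_apply_leg_eq (fun Y' => ‖kernel 𝕜 D (n + 1) Y'‖) (fun y' => ‖T' w' y'‖) p,
      ← sum_filter_add_sum_filter_not univ (fun y' : Γ₁' => Near y')]
    refine add_le_add ?_ ?_
    · calc ∑ y' ∈ univ.filter (fun y' : Γ₁' => Near y'),
            ‖T' w' y'‖ * ∑ Y' ∈ univ.filter (fun Y' : Fin (n + 1) → Γ₁' => Y' p = y'), ‖kernel 𝕜 D (n + 1) Y'‖
          ≤ ∑ y' ∈ univ.filter (fun y' : Γ₁' => Near y'), ‖T' w' y'‖ * E :=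
            sum_le_sum fun y' hy' => mul_le_mul_of_nonneg_left (hE y' (mem_filter.1 hy').2) (norm_nonneg _)
        _ = (∑ y' ∈ univ.filter (fun y' : Γ₁' => Near y'), ‖T' w' y'‖) * E := by rw [sum_mul]
        _ ≤ a * E := mul_le_mul_of_nonneg_right hrow hE0
    · calc ∑ y' ∈ univ.filter (fun y' : Γ₁' => ¬ Near y'),
            ‖T' w' y'‖ * ∑ Y' ∈ univ.filter (fun Y' : Fin (n + 1) → Γ₁' => Y' p = y'), ‖kernel 𝕜 D (n + 1) Y'‖
          ≤ ∑ y' ∈ univ.filter (fun y' : Γ₁' => ¬ Near y'), ‖T' w' y'‖ * ND :=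
            sum_le_sum fun y' _ => mul_le_mul_of_nonneg_left (hND y') (norm_nonneg _)
        _ = (∑ y' ∈ univ.filter (fun y' : Γ₁' => ¬ Near y'), ‖T' w' y'‖) * ND := by rw [sum_mul]
        _ ≤ τ * ND := mul_le_mul_of_nonneg_right hτ hND0
  calc ∑ X' ∈ Xp, ‖kernel 𝕜 (ExteriorAlgebra.map (Matrix.toLin' T') D) (n + 1) X'‖
      ≤ ∑ X' ∈ Xp, ∑ Y' : Fin (n + 1) → Γ₁', ‖kernel 𝕜 D (n + 1) Y'‖ * ∏ i, ‖T' (X' i) (Y' i)‖ := sum_le_sum fun X' _ => hpt X'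
    _ = ∑ Y' : Fin (n + 1) → Γ₁', ‖kernel 𝕜 D (n + 1) Y'‖ * ∑ X' ∈ Xp, ∏ i, ‖T' (X' i) (Y' i)‖ := by
        rw [sum_comm]; exact sum_congr rfl fun Y' _ => (mul_sum _ _ _).symm
    _ ≤ ∑ Y' : Fin (n + 1) → Γ₁', ‖kernel 𝕜 D (n + 1) Y'‖ * (‖T' w' (Y' p)‖ * a ^ n) :=
        sum_le_sum fun Y' _ => mul_le_mul_of_nonneg_left (hX Y') (norm_nonneg _)
    _ = a ^ n * ∑ Y' : Fin (n + 1) → Γ₁', ‖kernel 𝕜 D (n + 1) Y'‖ * ‖T' w' (Y' p)‖ := by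
        rw [mul_sum]; exact sum_congr rfl fun Y' _ => by ring
    _ ≤ a ^ n * (a * E + τ * ND) := mul_le_mul_of_nonneg_left hpin (pow_nonneg ha n)

/-- **Plain version** (no near region): `Σ_{X′ : X′_p = w′} ‖kernel (map T′ D) (n+1) X′‖ ≤ aⁿ·a·ND` for column sums and the pin's row `≤ a` and pinned
profile `≤ ND`. [folklore] -/
theorem sum_pinned_norm_kernel_map_le (T' : Matrix Γ₂' Γ₁' 𝕜) (D : GrassmannAlgebra 𝕜 Γ₁') {n : ℕ} (p : Fin (n + 1)) (w' : Γ₂')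
    {a ND : ℝ} (ha : 0 ≤ a) (hND0 : 0 ≤ ND) (hcol : ∀ y', ∑ x', ‖T' x' y'‖ ≤ a) (hrow : ∑ y', ‖T' w' y'‖ ≤ a)
    (hND : ∀ y', ∑ Y' ∈ univ.filter (fun Y' : Fin (n + 1) → Γ₁' => Y' p = y'), ‖kernel 𝕜 D (n + 1) Y'‖ ≤ ND) :
    ∑ X' ∈ univ.filter (fun X' : Fin (n + 1) → Γ₂' => X' p = w'), ‖kernel 𝕜 (ExteriorAlgebra.map (Matrix.toLin' T') D) (n + 1) X'‖ ≤
      a ^ n * (a * ND) := by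
  classical
  have h := sum_pinned_norm_kernel_map_le_of_near T' D p w' (fun _ => True) (τ := 0) ha hND0 hND0 hcol
    (by rw [filter_true_of_mem fun _ _ => trivial]; exact hrow)
    (by rw [filter_false_of_mem fun _ _ => not_not_intro trivial, sum_empty]) (fun y' _ => hND y') hND
  simpa only [zero_mul, add_zero] using h

end Summit.HubbardSuperconductivity.HubbardSuperconductivity.Theorems.TwoVolumeDefect

end
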